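import Summits.QuantumFields.YangMills.Theorems.PoincareLipschitzConeLinkChartRegion
import Literature.Analysis.FluidPDE.CylindricalIntegration
import Mathlib.MeasureTheory.Function.Jacobian
import HarnessLib

/-!
# Crux `BlockLipschitzL` (stmt-QuantumFields-23533) ∕ `HistoryTailL` (stmt-QuantumFields-19936), LINE 25 «CompactnessTransfer»,
# the (GAP)∕(TM) road (H), brick (T) «CONE → PLANE TRANSPORT» — FILE A3 «THE CHANGE OF VARIABLES ALONG THE CONE CHART»

Cell `ym3-torus` (YM ladder rung R3 = continuum SU(2) Yang–Mills on T³ — a RUNG, NOT Clay: not d = 4, not infinite volume,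
not a mass gap); WIDTH helper seat `ym3-torus-px16` g10, typing px14 g7's SPEC `SPEC-ConeLinkChart.px14g7.lean` §3 (rows (i)(ii)
of px14 16:31:31Z); `--supports stmt-QuantumFields-23533`; THEOREMS ONLY (0 `def`, 0 `sorry`, default heartbeats); imports FILE
A2 ✓`…PoincareLipschitzConeLinkChartRegion` (hence A1: `σ`, `c`, conformality, `π`, `V`), lit ✓`CylindricalIntegration`
(volume-preserving `cylSplit : E³ ≃ᵐ ℝ × E²`, `x ↦ (x₂, (x₀, x₁))`), lit ✓`GaussLattice3D` (via A1: `det_gram_eq_det_sq`), Mathlib.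

THE CHART `(t, y) ↦ t • σ y : (0, ∞) × E² → E³`, as the self-map `Ψ z := (z 2) • σ (z₀, z₁)` of `E³` (`= t • σ y` at
`z = cylSplit⁻¹ (t, y)`): smooth, derivative columns `t • Dσ e₀, t • Dσ e₁, σ` — an ORTHOGONAL frame of lengths `t c, t c, 1` (A1),
so `|det DΨ| = t² c²` by the Gram determinant (★ `abs_det_chartDeriv`); injective on `{0 < z 2}`; image of `{z 2 ∈ T}` =
`{‖x‖ ∈ T} ∩ V`, `V` of null complement (A2).
WHAT THIS FILE PROVES (SPEC §3, names verbatim).  ★★★ `setIntegral_norm_mem_eq_integral_chart`: for measurable `T ⊆ (0, ∞)` and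
EVERY `g : E³ → F` (no integrability hypothesis — both sides are junk together),
`∫_{‖x‖ ∈ T} g = ∫_{(t,y) ∈ T ×ˢ univ} (t²·c(y)²) • g (t • σ y)` (product-SET form on `ℝ × E²`; the iterated form follows by
`integral_prod` for the consumer); ★ `integrableOn_norm_mem_iff_integrableOn_chart`; ★ `setLIntegral_norm_mem_eq_lintegral_chart`
(the `ℝ≥0∞` twin); ★ `setIntegral_ball_eq_integral_chart` (`ball 0 R`, `T = (0,R)`); ★ `volume_chart_preimage_null` (null sets
of `E³` pull back to null sets of `(0,∞) × E²` — from the lintegral twin and `t²c² > 0`).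

HONEST SCOPE.  One change of variables; nothing of (T), (Q), (H), (F), (GAP), (TM), S1″, K1, `MeanDeviationL`, `BlockLipschitzL`,
`HistoryTailL` is proved here.  YM₃ on T³ is rung R3, not Clay; YM gap NOT proved; no summit statement is proved here.

References: L. C. Evans, R. F. Gariepy, Measure Theory and Fine Properties of Functions (1992) [EvansGariepy1992] (§3.3.3,
§3.4.4); R. Schoen, K. Uhlenbeck, Invent. Math. 78 (1984) 89–100 [SchoenUhlenbeck1984] (§1).
-/

set_option autoImplicit false

noncomputable section

open MeasureTheory Set Function Filter Topology Metric
open scoped RealInnerProductSpace BigOperators ContDiff ENNReal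

namespace Summit.QuantumFields.YangMills.Theorems.PoincareLipschitzConeLinkChart

open Literature.Analysis.FluidPDE (cylSplit measurePreserving_cylSplit cylSplit_apply_fst cylSplit_apply_snd_apply
  cylSplit_symm_apply_two cylSplit_symm_apply_zero cylSplit_symm_apply_one)
open Literature.Algebra.EuclideanLattices (det_gram_eq_det_sq)

variable {c : EuclideanSpace ℝ (Fin 2) → ℝ} {σ : EuclideanSpace ℝ (Fin 2) → EuclideanSpace ℝ (Fin 3)}

/-! ## §3a The chart as a self-map of `E³`: derivative, Jacobian, injectivity, image -/

/-- `(cylSplit z).2 = (z₀, z₁)`. [folklore] -/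
theorem cylSplit_snd_eq (z : EuclideanSpace ℝ (Fin 3)) :
    (cylSplit z).2 = (!₂[z 0, z 1] : EuclideanSpace ℝ (Fin 2)) := by
  ext j
  fin_cases j <;> rfl

/-- The horizontal projection `E³ → E²`, `z ↦ (z₀, z₁)`, as a continuous linear map; its values. [folklore] -/
theorem horProj_apply (z : EuclideanSpace ℝ (Fin 3)) :
    ((EuclideanSpace.proj (0 : Fin 3) : EuclideanSpace ℝ (Fin 3) →L[ℝ] ℝ).smulRight
        (EuclideanSpace.single (0 : Fin 2) (1:ℝ)) +
      (EuclideanSpace.proj (1 : Fin 3) : EuclideanSpace ℝ (Fin 3) →L[ℝ] ℝ).smulRight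
        (EuclideanSpace.single (1 : Fin 2) (1:ℝ))) z = (cylSplit z).2 := by
  rw [cylSplit_snd_eq]
  ext j
  fin_cases j <;> simp

/-- ★ **THE DERIVATIVE OF THE CHART** `Ψ z = (z 2) • σ (z₀, z₁)`: `DΨ_z v = v₂ • σ y + z₂ • Dσ_y (v₀, v₁)`. [folklore] -/
theorem hasFDerivAt_chart (hc : ∀ y, c y = 2 / (1 + ‖y‖ ^ 2))
    (hσ : ∀ y, σ y = !₂[c y * y 0, c y * y 1, c y - 1]) (z : EuclideanSpace ℝ (Fin 3)) :
    HasFDerivAt (fun z : EuclideanSpace ℝ (Fin 3) => (z 2) • σ (cylSplit z).2)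
      ((z 2) • ((fderiv ℝ σ (cylSplit z).2).comp
          ((EuclideanSpace.proj (0 : Fin 3) : EuclideanSpace ℝ (Fin 3) →L[ℝ] ℝ).smulRight
              (EuclideanSpace.single (0 : Fin 2) (1:ℝ)) +
            (EuclideanSpace.proj (1 : Fin 3) : EuclideanSpace ℝ (Fin 3) →L[ℝ] ℝ).smulRight
              (EuclideanSpace.single (1 : Fin 2) (1:ℝ)))) +
        (EuclideanSpace.proj (2 : Fin 3) : EuclideanSpace ℝ (Fin 3) →L[ℝ] ℝ).smulRight (σ (cylSplit z).2)) z := by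
  set P : EuclideanSpace ℝ (Fin 3) →L[ℝ] EuclideanSpace ℝ (Fin 2) :=
    (EuclideanSpace.proj (0 : Fin 3) : EuclideanSpace ℝ (Fin 3) →L[ℝ] ℝ).smulRight
        (EuclideanSpace.single (0 : Fin 2) (1:ℝ)) +
      (EuclideanSpace.proj (1 : Fin 3) : EuclideanSpace ℝ (Fin 3) →L[ℝ] ℝ).smulRight
        (EuclideanSpace.single (1 : Fin 2) (1:ℝ)) with hP
  have hPz : ∀ z', P z' = (cylSplit z').2 := fun z' => horProj_apply z'
  have hfun : (fun z : EuclideanSpace ℝ (Fin 3) => (z 2) • σ (cylSplit z).2) =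
      fun z => (fun z : EuclideanSpace ℝ (Fin 3) => z 2) z • (fun z => σ (P z)) z := by
    funext z'
    simp only [hPz]
  have h1 : HasFDerivAt (fun z : EuclideanSpace ℝ (Fin 3) => z 2)
      (EuclideanSpace.proj (2 : Fin 3) : EuclideanSpace ℝ (Fin 3) →L[ℝ] ℝ) z :=
    (EuclideanSpace.proj (2 : Fin 3) : EuclideanSpace ℝ (Fin 3) →L[ℝ] ℝ).hasFDerivAt
  have h2 : HasFDerivAt (fun z => σ (P z)) ((fderiv ℝ σ (P z)).comp P) z :=
    (differentiable_sigma hc hσ (P z)).hasFDerivAt.comp z P.hasFDerivAt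
  have h := h1.smul h2
  rw [hPz z] at h
  rw [hfun]
  exact h

/-- The columns of `DΨ_z`: `DΨ e₀ = z₂ • Dσ e₀`, `DΨ e₁ = z₂ • Dσ e₁`, `DΨ e₂ = σ`. [folklore] -/
theorem chartDeriv_apply_single (z : EuclideanSpace ℝ (Fin 3)) :
    ((z 2) • ((fderiv ℝ σ (cylSplit z).2).comp
          ((EuclideanSpace.proj (0 : Fin 3) : EuclideanSpace ℝ (Fin 3) →L[ℝ] ℝ).smulRight
              (EuclideanSpace.single (0 : Fin 2) (1:ℝ)) +
            (EuclideanSpace.proj (1 : Fin 3) : EuclideanSpace ℝ (Fin 3) →L[ℝ] ℝ).smulRight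
              (EuclideanSpace.single (1 : Fin 2) (1:ℝ)))) +
        (EuclideanSpace.proj (2 : Fin 3) : EuclideanSpace ℝ (Fin 3) →L[ℝ] ℝ).smulRight (σ (cylSplit z).2))
        (EuclideanSpace.single 0 (1:ℝ)) = (z 2) • fderiv ℝ σ (cylSplit z).2 (EuclideanSpace.single 0 (1:ℝ)) ∧
    ((z 2) • ((fderiv ℝ σ (cylSplit z).2).comp
          ((EuclideanSpace.proj (0 : Fin 3) : EuclideanSpace ℝ (Fin 3) →L[ℝ] ℝ).smulRight
              (EuclideanSpace.single (0 : Fin 2) (1:ℝ)) +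
            (EuclideanSpace.proj (1 : Fin 3) : EuclideanSpace ℝ (Fin 3) →L[ℝ] ℝ).smulRight
              (EuclideanSpace.single (1 : Fin 2) (1:ℝ)))) +
        (EuclideanSpace.proj (2 : Fin 3) : EuclideanSpace ℝ (Fin 3) →L[ℝ] ℝ).smulRight (σ (cylSplit z).2))
        (EuclideanSpace.single 1 (1:ℝ)) = (z 2) • fderiv ℝ σ (cylSplit z).2 (EuclideanSpace.single 1 (1:ℝ)) ∧
    ((z 2) • ((fderiv ℝ σ (cylSplit z).2).comp
          ((EuclideanSpace.proj (0 : Fin 3) : EuclideanSpace ℝ (Fin 3) →L[ℝ] ℝ).smulRight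
              (EuclideanSpace.single (0 : Fin 2) (1:ℝ)) +
            (EuclideanSpace.proj (1 : Fin 3) : EuclideanSpace ℝ (Fin 3) →L[ℝ] ℝ).smulRight
              (EuclideanSpace.single (1 : Fin 2) (1:ℝ)))) +
        (EuclideanSpace.proj (2 : Fin 3) : EuclideanSpace ℝ (Fin 3) →L[ℝ] ℝ).smulRight (σ (cylSplit z).2))
        (EuclideanSpace.single 2 (1:ℝ)) = σ (cylSplit z).2 := by
  refine ⟨?_, ?_, ?_⟩
  · simp
  · simp
  · simp

/-- **`(det L)²` IS THE GRAM DETERMINANT OF THE COLUMNS OF `L`** (lit `det_gram_eq_det_sq` on `LinearMap.toMatrix`). [folklore] -/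
theorem det_sq_eq_det_gram (L : EuclideanSpace ℝ (Fin 3) →L[ℝ] EuclideanSpace ℝ (Fin 3)) :
    L.det ^ 2 = Matrix.det !![‖L (EuclideanSpace.single 0 (1:ℝ))‖ ^ 2,
        ⟪L (EuclideanSpace.single 0 (1:ℝ)), L (EuclideanSpace.single 1 (1:ℝ))⟫,
        ⟪L (EuclideanSpace.single 0 (1:ℝ)), L (EuclideanSpace.single 2 (1:ℝ))⟫;
      ⟪L (EuclideanSpace.single 0 (1:ℝ)), L (EuclideanSpace.single 1 (1:ℝ))⟫, ‖L (EuclideanSpace.single 1 (1:ℝ))‖ ^ 2,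
        ⟪L (EuclideanSpace.single 1 (1:ℝ)), L (EuclideanSpace.single 2 (1:ℝ))⟫;
      ⟪L (EuclideanSpace.single 0 (1:ℝ)), L (EuclideanSpace.single 2 (1:ℝ))⟫,
        ⟪L (EuclideanSpace.single 1 (1:ℝ)), L (EuclideanSpace.single 2 (1:ℝ))⟫, ‖L (EuclideanSpace.single 2 (1:ℝ))‖ ^ 2] := by
  rw [det_gram_eq_det_sq]
  have h1 : L.det = Matrix.det (LinearMap.toMatrix (EuclideanSpace.basisFun (Fin 3) ℝ).toBasis
      (EuclideanSpace.basisFun (Fin 3) ℝ).toBasis (L : EuclideanSpace ℝ (Fin 3) →ₗ[ℝ] EuclideanSpace ℝ (Fin 3))) :=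
    (LinearMap.det_toMatrix _ _).symm
  have h2 : (LinearMap.toMatrix (EuclideanSpace.basisFun (Fin 3) ℝ).toBasis (EuclideanSpace.basisFun (Fin 3) ℝ).toBasis
      (L : EuclideanSpace ℝ (Fin 3) →ₗ[ℝ] EuclideanSpace ℝ (Fin 3))).transpose =
      Matrix.of fun i j => (![L (EuclideanSpace.single 0 (1:ℝ)), L (EuclideanSpace.single 1 (1:ℝ)),
        L (EuclideanSpace.single 2 (1:ℝ))] i) j := by
    ext i j
    rw [Matrix.transpose_apply, LinearMap.toMatrix_apply, Matrix.of_apply, OrthonormalBasis.coe_toBasis_repr_apply,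
      EuclideanSpace.basisFun_repr, OrthonormalBasis.coe_toBasis, EuclideanSpace.basisFun_apply,
      ContinuousLinearMap.coe_coe]
    fin_cases i <;> simp
  rw [h1, ← Matrix.det_transpose, h2]

/-- ★ **THE JACOBIAN OF THE CHART**: `|det DΨ_z| = z₂² · c(y)²` — the columns `z₂ • Dσ e₀, z₂ • Dσ e₁, σ` are orthogonal
of lengths `|z₂| c, |z₂| c, 1` (A1), so the Gram matrix is `diag(z₂²c², z₂²c², 1)`. [folklore] -/
theorem abs_det_chartDeriv (hc : ∀ y, c y = 2 / (1 + ‖y‖ ^ 2))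
    (hσ : ∀ y, σ y = !₂[c y * y 0, c y * y 1, c y - 1]) (z : EuclideanSpace ℝ (Fin 3)) :
    |((z 2) • ((fderiv ℝ σ (cylSplit z).2).comp
          ((EuclideanSpace.proj (0 : Fin 3) : EuclideanSpace ℝ (Fin 3) →L[ℝ] ℝ).smulRight
              (EuclideanSpace.single (0 : Fin 2) (1:ℝ)) +
            (EuclideanSpace.proj (1 : Fin 3) : EuclideanSpace ℝ (Fin 3) →L[ℝ] ℝ).smulRight
              (EuclideanSpace.single (1 : Fin 2) (1:ℝ)))) +
        (EuclideanSpace.proj (2 : Fin 3) : EuclideanSpace ℝ (Fin 3) →L[ℝ] ℝ).smulRight (σ (cylSplit z).2)).det| =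
      (z 2) ^ 2 * c (cylSplit z).2 ^ 2 := by
  obtain ⟨h0, h1, h2⟩ := chartDeriv_apply_single (σ := σ) z
  set L := ((z 2) • ((fderiv ℝ σ (cylSplit z).2).comp
          ((EuclideanSpace.proj (0 : Fin 3) : EuclideanSpace ℝ (Fin 3) →L[ℝ] ℝ).smulRight
              (EuclideanSpace.single (0 : Fin 2) (1:ℝ)) +
            (EuclideanSpace.proj (1 : Fin 3) : EuclideanSpace ℝ (Fin 3) →L[ℝ] ℝ).smulRight
              (EuclideanSpace.single (1 : Fin 2) (1:ℝ)))) +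
        (EuclideanSpace.proj (2 : Fin 3) : EuclideanSpace ℝ (Fin 3) →L[ℝ] ℝ).smulRight (σ (cylSplit z).2)) with hL
  set y := (cylSplit z).2 with hy
  set t := z 2 with ht
  -- the Gram matrix entries
  have hn : ∀ k : Fin 2, ‖fderiv ℝ σ y (EuclideanSpace.single k (1:ℝ))‖ = c y := fun k => by
    rw [norm_fderiv_sigma hc hσ]; simp
  have g00 : ‖L (EuclideanSpace.single 0 (1:ℝ))‖ ^ 2 = t ^ 2 * c y ^ 2 := by
    rw [h0, norm_smul, hn, mul_pow, Real.norm_eq_abs, sq_abs]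
  have g11 : ‖L (EuclideanSpace.single 1 (1:ℝ))‖ ^ 2 = t ^ 2 * c y ^ 2 := by
    rw [h1, norm_smul, hn, mul_pow, Real.norm_eq_abs, sq_abs]
  have g22 : ‖L (EuclideanSpace.single 2 (1:ℝ))‖ ^ 2 = 1 := by
    rw [h2, norm_sigma hc hσ, one_pow]
  have g01 : ⟪L (EuclideanSpace.single 0 (1:ℝ)), L (EuclideanSpace.single 1 (1:ℝ))⟫ = 0 := by
    rw [h0, h1, real_inner_smul_left, real_inner_smul_right, inner_fderiv_sigma hc hσ,
      EuclideanSpace.inner_single_left]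
    simp
  have g02 : ⟪L (EuclideanSpace.single 0 (1:ℝ)), L (EuclideanSpace.single 2 (1:ℝ))⟫ = 0 := by
    rw [h0, h2, real_inner_smul_left, real_inner_comm, inner_sigma_fderiv_sigma hc hσ, mul_zero]
  have g12 : ⟪L (EuclideanSpace.single 1 (1:ℝ)), L (EuclideanSpace.single 2 (1:ℝ))⟫ = 0 := by
    rw [h1, h2, real_inner_smul_left, real_inner_comm, inner_sigma_fderiv_sigma hc hσ, mul_zero]
  have hsq : L.det ^ 2 = (t ^ 2 * c y ^ 2) ^ 2 := by
    rw [det_sq_eq_det_gram, g00, g11, g22, g01, g02, g12, Matrix.det_fin_three]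
    simp
    ring
  have habs := (sq_eq_sq_iff_abs_eq_abs _ _).1 hsq
  rw [habs, abs_of_nonneg (by positivity)]

/-- The chart is injective on the open half-space `{0 < z₂}` (norms give `z₂`, then `σ` is injective). [folklore] -/
theorem injOn_chart (hc : ∀ y, c y = 2 / (1 + ‖y‖ ^ 2))
    (hσ : ∀ y, σ y = !₂[c y * y 0, c y * y 1, c y - 1]) :
    InjOn (fun z : EuclideanSpace ℝ (Fin 3) => (z 2) • σ (cylSplit z).2) {z : EuclideanSpace ℝ (Fin 3) | 0 < z 2} := by
  intro z hz z' hz' h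
  have hz0 : 0 < z 2 := hz
  have hz0' : 0 < z' 2 := hz'
  have ht : z 2 = z' 2 := by
    have hn := congrArg (fun x : EuclideanSpace ℝ (Fin 3) => ‖x‖) h
    simp only [norm_smul_sigma hc hσ, abs_of_pos hz0, abs_of_pos hz0'] at hn
    exact hn
  have hs : σ (cylSplit z).2 = σ (cylSplit z').2 := by
    have h' : (z 2) • σ (cylSplit z).2 = (z 2) • σ (cylSplit z').2 := by
      have := h; simp only at this; rw [this, ht]
    exact smul_right_injective _ hz0.ne' h'
  have hy := sigma_injective hc hσ hs
  rw [cylSplit_snd_eq, cylSplit_snd_eq] at hy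
  obtain ⟨a0, a1⟩ := vec2_apply (z 0) (z 1)
  obtain ⟨b0, b1⟩ := vec2_apply (z' 0) (z' 1)
  have e0 : (!₂[z 0, z 1] : EuclideanSpace ℝ (Fin 2)) 0 = (!₂[z' 0, z' 1] : EuclideanSpace ℝ (Fin 2)) 0 := by rw [hy]
  have e1 : (!₂[z 0, z 1] : EuclideanSpace ℝ (Fin 2)) 1 = (!₂[z' 0, z' 1] : EuclideanSpace ℝ (Fin 2)) 1 := by rw [hy]
  rw [a0, b0] at e0
  rw [a1, b1] at e1
  ext i
  fin_cases i
  · exact e0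
  · exact e1
  · exact ht

/-- **THE IMAGE OF A SLAB** `{z₂ ∈ T}` (`T ⊆ (0,∞)`) under the chart is `{‖x‖ ∈ T} ∩ V` (A2 `smul_sigma_mem_V`,
`norm_smul_sigma_pi`). [folklore] -/
theorem image_chart_eq (hc : ∀ y, c y = 2 / (1 + ‖y‖ ^ 2))
    (hσ : ∀ y, σ y = !₂[c y * y 0, c y * y 1, c y - 1]) {T : Set ℝ} (hT0 : T ⊆ Ioi 0) :
    (fun z : EuclideanSpace ℝ (Fin 3) => (z 2) • σ (cylSplit z).2) '' {z : EuclideanSpace ℝ (Fin 3) | z 2 ∈ T} =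
      {x : EuclideanSpace ℝ (Fin 3) | ‖x‖ ∈ T} ∩ {x : EuclideanSpace ℝ (Fin 3) | 0 < ‖x‖ + x 2} := by
  ext x
  constructor
  · rintro ⟨z, hz, rfl⟩
    have hz' : z 2 ∈ T := hz
    have ht : 0 < z 2 := hT0 hz'
    refine ⟨?_, smul_sigma_mem_V hc hσ ht _⟩
    show ‖(z 2) • σ (cylSplit z).2‖ ∈ T
    rw [norm_smul_sigma hc hσ, abs_of_pos ht]
    exact hz'
  · rintro ⟨hxT, hxV⟩
    have hxT' : ‖x‖ ∈ T := hxT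
    have hxV' : 0 < ‖x‖ + x 2 := hxV
    refine ⟨cylSplit.symm (‖x‖, (‖x‖ + x 2)⁻¹ • !₂[x 0, x 1]), ?_, ?_⟩
    · show (cylSplit.symm (‖x‖, (‖x‖ + x 2)⁻¹ • !₂[x 0, x 1])) 2 ∈ T
      rw [cylSplit_symm_apply_two]
      exact hxT'
    · show (cylSplit.symm (‖x‖, (‖x‖ + x 2)⁻¹ • !₂[x 0, x 1])) 2 •
          σ (cylSplit (cylSplit.symm (‖x‖, (‖x‖ + x 2)⁻¹ • !₂[x 0, x 1]))).2 = x
      rw [cylSplit_symm_apply_two, MeasurableEquiv.apply_symm_apply]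
      exact norm_smul_sigma_pi (π := fun x : EuclideanSpace ℝ (Fin 3) => (‖x‖ + x 2)⁻¹ • !₂[x 0, x 1]) hc hσ
        (fun _ => rfl) hxV'

/-- The slab `{z₂ ∈ T}` is measurable and is the `cylSplit`-preimage of `T ×ˢ univ`. [folklore] -/
theorem slab_eq_preimage (T : Set ℝ) :
    {z : EuclideanSpace ℝ (Fin 3) | z 2 ∈ T} = cylSplit ⁻¹' (T ×ˢ (univ : Set (EuclideanSpace ℝ (Fin 2)))) := by
  ext z
  simp [mem_prod, cylSplit_apply_fst]

/-- Measurability of the slab. [folklore] -/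
theorem measurableSet_slab {T : Set ℝ} (hT : MeasurableSet T) :
    MeasurableSet {z : EuclideanSpace ℝ (Fin 3) | z 2 ∈ T} :=
  hT.preimage (contDiff_apply_three 2).continuous.measurable

/-- `{‖x‖ ∈ T} ∩ V` and `{‖x‖ ∈ T}` agree up to a Lebesgue-null set (A2 `volume_compl_V`). [folklore] -/
theorem norm_mem_inter_V_ae_eq (T : Set ℝ) :
    ({x : EuclideanSpace ℝ (Fin 3) | ‖x‖ ∈ T} ∩ {x : EuclideanSpace ℝ (Fin 3) | 0 < ‖x‖ + x 2} : Set _) =ᵐ[volume]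
      ({x : EuclideanSpace ℝ (Fin 3) | ‖x‖ ∈ T} : Set _) := by
  have hV : ({x : EuclideanSpace ℝ (Fin 3) | 0 < ‖x‖ + x 2} : Set _) =ᵐ[volume] (univ : Set _) :=
    ae_eq_univ.2 volume_compl_V
  have h := (EventuallyEq.refl _ ({x : EuclideanSpace ℝ (Fin 3) | ‖x‖ ∈ T} : Set _)).inter hV
  rwa [inter_univ] at h

/-! ## §3b The change of variables -/

/-- ★★★ **CHANGE OF VARIABLES ALONG THE CONE CHART, Bochner form**: for every measurable `T ⊆ (0, ∞)` and every `g`,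
`∫_{‖x‖ ∈ T} g = ∫_{(t,y) ∈ T × E²} (t²·c(y)²) • g (t • σ y)` (no integrability hypothesis: Mathlib's Jacobian formula for the
injective smooth self-map `Ψ` of `E³` on the slab, transported to `ℝ × E²` by the volume-preserving `cylSplit`, the null ray
discarded). [cite: EvansGariepy1992, §3.3.3 Theorem 2 and §3.4.4] -/
theorem setIntegral_norm_mem_eq_integral_chart {F : Type*} [NormedAddCommGroup F] [NormedSpace ℝ F]
    (hc : ∀ y, c y = 2 / (1 + ‖y‖ ^ 2))
    (hσ : ∀ y, σ y = !₂[c y * y 0, c y * y 1, c y - 1]) {T : Set ℝ} (hT : MeasurableSet T)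
    (hT0 : T ⊆ Ioi 0) (g : EuclideanSpace ℝ (Fin 3) → F) :
    ∫ x in {x : EuclideanSpace ℝ (Fin 3) | ‖x‖ ∈ T}, g x =
      ∫ q in T ×ˢ (univ : Set (EuclideanSpace ℝ (Fin 2))), (q.1 ^ 2 * c q.2 ^ 2) • g (q.1 • σ q.2) := by
  have hS := measurableSet_slab hT
  have hder : ∀ z ∈ {z : EuclideanSpace ℝ (Fin 3) | z 2 ∈ T}, HasFDerivWithinAt
      (fun z : EuclideanSpace ℝ (Fin 3) => (z 2) • σ (cylSplit z).2) _ {z : EuclideanSpace ℝ (Fin 3) | z 2 ∈ T} z :=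
    fun z _ => (hasFDerivAt_chart hc hσ z).hasFDerivWithinAt
  have hinj : InjOn (fun z : EuclideanSpace ℝ (Fin 3) => (z 2) • σ (cylSplit z).2)
      {z : EuclideanSpace ℝ (Fin 3) | z 2 ∈ T} := (injOn_chart hc hσ).mono fun z hz => hT0 hz
  have hcov := integral_image_eq_integral_abs_det_fderiv_smul volume hS hder hinj g
  rw [image_chart_eq hc hσ hT0, setIntegral_congr_set (norm_mem_inter_V_ae_eq T)] at hcov
  rw [hcov, ← (measurePreserving_cylSplit.setIntegral_preimage_emb cylSplit.measurableEmbedding _ _),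
    ← slab_eq_preimage]
  refine setIntegral_congr_fun hS fun z _ => ?_
  simp only [abs_det_chartDeriv hc hσ, cylSplit_apply_fst]

/-- ★ **Integrability twin** of the change of variables. [cite: EvansGariepy1992, §3.3.3 Theorem 2] -/
theorem integrableOn_norm_mem_iff_integrableOn_chart {F : Type*} [NormedAddCommGroup F] [NormedSpace ℝ F]
    (hc : ∀ y, c y = 2 / (1 + ‖y‖ ^ 2))
    (hσ : ∀ y, σ y = !₂[c y * y 0, c y * y 1, c y - 1]) {T : Set ℝ} (hT : MeasurableSet T)
    (hT0 : T ⊆ Ioi 0) (g : EuclideanSpace ℝ (Fin 3) → F) :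
    IntegrableOn g {x : EuclideanSpace ℝ (Fin 3) | ‖x‖ ∈ T} volume ↔
      IntegrableOn (fun q : ℝ × EuclideanSpace ℝ (Fin 2) => (q.1 ^ 2 * c q.2 ^ 2) • g (q.1 • σ q.2))
        (T ×ˢ (univ : Set (EuclideanSpace ℝ (Fin 2)))) volume := by
  have hS := measurableSet_slab hT
  have hder : ∀ z ∈ {z : EuclideanSpace ℝ (Fin 3) | z 2 ∈ T}, HasFDerivWithinAt
      (fun z : EuclideanSpace ℝ (Fin 3) => (z 2) • σ (cylSplit z).2) _ {z : EuclideanSpace ℝ (Fin 3) | z 2 ∈ T} z :=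
    fun z _ => (hasFDerivAt_chart hc hσ z).hasFDerivWithinAt
  have hinj : InjOn (fun z : EuclideanSpace ℝ (Fin 3) => (z 2) • σ (cylSplit z).2)
      {z : EuclideanSpace ℝ (Fin 3) | z 2 ∈ T} := (injOn_chart hc hσ).mono fun z hz => hT0 hz
  have hcov := integrableOn_image_iff_integrableOn_abs_det_fderiv_smul volume hS hder hinj g
  rw [image_chart_eq hc hσ hT0, integrableOn_congr_set_ae (norm_mem_inter_V_ae_eq T)] at hcov
  rw [hcov, ← (measurePreserving_cylSplit.integrableOn_comp_preimage cylSplit.measurableEmbedding),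
    ← slab_eq_preimage]
  refine integrableOn_congr_fun (fun z _ => ?_) hS
  simp only [comp_apply, abs_det_chartDeriv hc hσ, cylSplit_apply_fst]

/-- ★ **Lintegral twin** of the change of variables (no integrability needed). [cite: EvansGariepy1992, §3.3.3 Theorem 2] -/
theorem setLIntegral_norm_mem_eq_lintegral_chart
    (hc : ∀ y, c y = 2 / (1 + ‖y‖ ^ 2))
    (hσ : ∀ y, σ y = !₂[c y * y 0, c y * y 1, c y - 1]) {T : Set ℝ} (hT : MeasurableSet T)
    (hT0 : T ⊆ Ioi 0) (g : EuclideanSpace ℝ (Fin 3) → ℝ≥0∞) :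
    ∫⁻ x in {x : EuclideanSpace ℝ (Fin 3) | ‖x‖ ∈ T}, g x =
      ∫⁻ q in T ×ˢ (univ : Set (EuclideanSpace ℝ (Fin 2))), ENNReal.ofReal (q.1 ^ 2 * c q.2 ^ 2) * g (q.1 • σ q.2) := by
  have hS := measurableSet_slab hT
  have hder : ∀ z ∈ {z : EuclideanSpace ℝ (Fin 3) | z 2 ∈ T}, HasFDerivWithinAt
      (fun z : EuclideanSpace ℝ (Fin 3) => (z 2) • σ (cylSplit z).2) _ {z : EuclideanSpace ℝ (Fin 3) | z 2 ∈ T} z :=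
    fun z _ => (hasFDerivAt_chart hc hσ z).hasFDerivWithinAt
  have hinj : InjOn (fun z : EuclideanSpace ℝ (Fin 3) => (z 2) • σ (cylSplit z).2)
      {z : EuclideanSpace ℝ (Fin 3) | z 2 ∈ T} := (injOn_chart hc hσ).mono fun z hz => hT0 hz
  have hcov := lintegral_image_eq_lintegral_abs_det_fderiv_mul volume hS hder hinj g
  rw [image_chart_eq hc hσ hT0, setLIntegral_congr (norm_mem_inter_V_ae_eq T)] at hcov
  rw [hcov, ← (measurePreserving_cylSplit.setLIntegral_comp_preimage_emb cylSplit.measurableEmbedding _ _),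
    ← slab_eq_preimage]
  refine setLIntegral_congr_fun hS fun z _ => ?_
  simp only [abs_det_chartDeriv hc hσ, cylSplit_apply_fst]

/-- ★ **Ball form**: `∫_{B_R(0)} g = ∫_{(t,y) ∈ (0,R) × E²} (t²·c(y)²) • g (t • σ y)` (`{‖x‖ ∈ (0, R)}` and `ball 0 R` differ by the
null set `{0}`; no sign hypothesis on `R` is needed — for `R ≤ 0` both sides vanish). [cite: EvansGariepy1992, §3.4.4] -/
theorem setIntegral_ball_eq_integral_chart {F : Type*} [NormedAddCommGroup F] [NormedSpace ℝ F]
    (hc : ∀ y, c y = 2 / (1 + ‖y‖ ^ 2))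
    (hσ : ∀ y, σ y = !₂[c y * y 0, c y * y 1, c y - 1]) (R : ℝ)
    (g : EuclideanSpace ℝ (Fin 3) → F) :
    ∫ x in ball (0 : EuclideanSpace ℝ (Fin 3)) R, g x =
      ∫ q in (Ioo 0 R) ×ˢ (univ : Set (EuclideanSpace ℝ (Fin 2))), (q.1 ^ 2 * c q.2 ^ 2) • g (q.1 • σ q.2) := by
  have hset : ({x : EuclideanSpace ℝ (Fin 3) | ‖x‖ ∈ Ioo 0 R} : Set _) =
      ball (0 : EuclideanSpace ℝ (Fin 3)) R \ {0} := by
    ext x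
    rw [mem_setOf_eq, mem_Ioo, Set.mem_sdiff, mem_ball_zero_iff, mem_singleton_iff, norm_pos_iff]
    tauto
  have hae : ({x : EuclideanSpace ℝ (Fin 3) | ‖x‖ ∈ Ioo 0 R} : Set _) =ᵐ[volume] ball (0 : EuclideanSpace ℝ (Fin 3)) R := by
    rw [hset]
    exact sdiff_ae_eq_self.2 (measure_mono_null inter_subset_right (measure_singleton _))
  rw [← setIntegral_congr_set hae]
  exact setIntegral_norm_mem_eq_integral_chart hc hσ measurableSet_Ioo (fun t ht => ht.1) g

/-- ★ **NULL-SET PULL-BACK**: the chart pulls Lebesgue-null sets of `E³` back to null sets of `(0,∞) × E²` (lintegral twin on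
the indicator of a measurable null cover, and `t²c² > 0`). [cite: EvansGariepy1992, §3.3.3 Theorem 2] -/
theorem volume_chart_preimage_null (hc : ∀ y, c y = 2 / (1 + ‖y‖ ^ 2))
    (hσ : ∀ y, σ y = !₂[c y * y 0, c y * y 1, c y - 1]) {N : Set (EuclideanSpace ℝ (Fin 3))}
    (hN : volume N = 0) :
    volume {q : ℝ × EuclideanSpace ℝ (Fin 2) | 0 < q.1 ∧ q.1 • σ q.2 ∈ N} = 0 := by
  set M := toMeasurable volume N with hM
  have hMm : MeasurableSet M := measurableSet_toMeasurable _ _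
  have hM0 : volume M = 0 := by rw [hM, measure_toMeasurable]; exact hN
  have hNM : N ⊆ M := subset_toMeasurable _ _
  have h := setLIntegral_norm_mem_eq_lintegral_chart hc hσ measurableSet_Ioi Subset.rfl
    (M.indicator fun _ => (1 : ℝ≥0∞))
  have hL : ∫⁻ x in {x : EuclideanSpace ℝ (Fin 3) | ‖x‖ ∈ Ioi 0}, M.indicator (fun _ => (1 : ℝ≥0∞)) x = 0 := by
    refine le_antisymm ?_ bot_le
    calc ∫⁻ x in {x : EuclideanSpace ℝ (Fin 3) | ‖x‖ ∈ Ioi 0}, M.indicator (fun _ => (1 : ℝ≥0∞)) x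
        ≤ ∫⁻ x, M.indicator (fun _ => (1 : ℝ≥0∞)) x := setLIntegral_le_lintegral _ _
      _ = volume M := lintegral_indicator_one hMm
      _ = 0 := hM0
  rw [hL] at h
  -- measurability of the integrand on the chart side
  have hσm : Measurable σ := (contDiff_sigma hc hσ).continuous.measurable
  have hcm : Measurable c := (contDiff_c hc).continuous.measurable
  have hΦ : Measurable (fun q : ℝ × EuclideanSpace ℝ (Fin 2) => q.1 • σ q.2) :=
    measurable_fst.smul (hσm.comp measurable_snd)
  have hJ : Measurable (fun q : ℝ × EuclideanSpace ℝ (Fin 2) => ENNReal.ofReal (q.1 ^ 2 * c q.2 ^ 2)) :=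
    ENNReal.measurable_ofReal.comp ((measurable_fst.pow_const 2).mul ((hcm.comp measurable_snd).pow_const 2))
  have hind : Measurable (fun q : ℝ × EuclideanSpace ℝ (Fin 2) => M.indicator (fun _ => (1 : ℝ≥0∞)) (q.1 • σ q.2)) :=
    (measurable_const.indicator hMm).comp hΦ
  have hae : ∀ᵐ q : ℝ × EuclideanSpace ℝ (Fin 2) ∂volume, q ∈ Ioi (0:ℝ) ×ˢ (univ : Set (EuclideanSpace ℝ (Fin 2))) →
      ENNReal.ofReal (q.1 ^ 2 * c q.2 ^ 2) * M.indicator (fun _ => (1 : ℝ≥0∞)) (q.1 • σ q.2) = 0 := by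
    have h0 := (lintegral_eq_zero_iff (hJ.mul hind)).1 h.symm
    rw [Filter.EventuallyEq, ae_restrict_iff' (measurableSet_Ioi.prod MeasurableSet.univ)] at h0
    filter_upwards [h0] with q hq hmem
    simpa only [Pi.mul_apply, Pi.zero_apply] using hq hmem
  refine measure_mono_null (fun q hq => ?_) (ae_iff.1 hae)
  obtain ⟨hq1, hqN⟩ := hq
  simp only [mem_setOf_eq]
  intro himp
  have h0 := himp (mem_prod.2 ⟨hq1, mem_univ _⟩)
  rw [indicator_of_mem (hNM hqN), mul_one] at h0
  exact (ENNReal.ofReal_pos.2 (mul_pos (pow_pos hq1 2) (pow_pos (c_pos hc q.2) 2))).ne' h0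

end Summit.QuantumFields.YangMills.Theorems.PoincareLipschitzConeLinkChart

end
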